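import Summits.RiemannHypothesis.RiemannHypothesis.Theorems.SignConeCondRungPlattTrudgianTwo

/-!
# Krein–Turán rung — skeleton (crux strategist s1, stmt-RiemannHypothesis-16301; plan `KREIN-TURAN-RUNG.md`)

Target: the SUPPORT item `SignConeUpTo210` (stmt-RiemannHypothesis-17940) in its honest, Platt–Trudgian-conditional form
`platt_trudgian_numerical_rh → (item body with a ≤ (log 210)/2)` — composed here SORRY-FREE from three stubs:

* `stub_schurTest`      — the elementary Schur test: a positive step weight `w` with `A w ≤ Π_up · w` on `I = [-L/2, L/2]`
                           (`A` = the symmetrised sum of node translations) gives the Krein–Turán bound `KreinTuranBound N L Π_up`;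
* `stub_schurWeight_210` — the certificate: such a `w` exists for `N = 210`, `L = 5.348 (> log 210 + 20h)`, `Π_up = 18`
                           (numerics: Π(210) = 16.29, uniform-cell Schur value 17.90; KREIN-TURAN-RUNG.md §1, §3);
* `stub_unitSlackWeil_210_of_plattTrudgian` — Theorem A′ (Krein–Turán form) instantiated at `b = (log 210)/2`: RH to height
                           `3.0·10¹²` + the Krein–Turán bound ⇒ Weil's functional with unit slack on `[-b, b]` (test split
                           `U = U⋆Ψ + V`, one mollifier power on the zero side, archimedean credit `g₀ = 21.0 ≥ Π_up`; §2).

The composition `signConeUpTo210_of_plattTrudgian` is the pattern of `signConeInequality_upTo_two_of_plattTrudgian` verbatim.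
-/

noncomputable section

set_option linter.dupNamespace false

open scoped BigOperators ComplexConjugate Real Topology ArithmeticFunction.vonMangoldt
open Complex MeasureTheory Set Filter

namespace Summit.RiemannHypothesis.RiemannHypothesis.Cruxes.SignConeInequality.KreinTuran

open Literature.NumberTheory.LFunctions
open Summit.RiemannHypothesis.RiemannHypothesis.Theorems.SignCone

/-- **Krein–Turán bound** for the honest comb `aₙ = 2Λ(n)/√n`, `n ≤ N`, on autocorrelations of tests supported in
`[-L/2, L/2]`: `Σₙ aₙ Re (v⋆ṽ)(log n) ≤ Π_up ‖v‖₂²`. [folklore] -/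
def KreinTuranBound (N : ℕ) (L Pup : ℝ) : Prop :=
  ∀ v : ℝ → ℂ, IsWeilTest v → tsupport v ⊆ Icc (-(L / 2)) (L / 2) →
    ∑ n ∈ Finset.range (N + 1), 2 * Λ n / Real.sqrt n * ((weilConv v (weilReflect v)) (Real.log n)).re ≤ Pup * weilNorm2Sq v

/-- **Schur weight**: a step weight `w`, positive and bounded on `I = [-L/2, L/2]`, with `(A w)(x) ≤ Π_up · w(x)` on `I`, where
`(A w)(x) = Σₙ (aₙ/2) [w(x − log n)·1_I(x − log n) + w(x + log n)·1_I(x + log n)]`. [folklore] -/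
def SchurWeight (N : ℕ) (L Pup : ℝ) (w : ℝ → ℝ) : Prop :=
  Measurable w ∧ (∃ c C : ℝ, 0 < c ∧ ∀ x ∈ Icc (-(L / 2)) (L / 2), c ≤ w x ∧ w x ≤ C) ∧
  ∀ x ∈ Icc (-(L / 2)) (L / 2),
    ∑ n ∈ Finset.range (N + 1), (2 * Λ n / Real.sqrt n) / 2 *
      ((Icc (-(L / 2)) (L / 2)).indicator w (x - Real.log n) + (Icc (-(L / 2)) (L / 2)).indicator w (x + Real.log n))
      ≤ Pup * w x

/-- STUB 1 (elementary, ~80–150 lines): the Schur test — per node `2 Re v(x) v̄(x−t) ≤ (w(x−t)/w(x))|v(x)|² + (w(x)/w(x−t))|v(x−t)|²`,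
integrate over the overlap, re-index the second integral, sum with weights `aₙ/2`. [folklore] -/
theorem stub_schurTest {N : ℕ} {L Pup : ℝ} {w : ℝ → ℝ} (hw : SchurWeight N L Pup w) : KreinTuranBound N L Pup := by
  sorry

/-- STUB 2 (certificate, `decide +kernel` over a rational step table of ~600–1200 cells incl. the breakpoints `∓L/2 ± log n`,
`log n` enclosed by interval tables): a Schur weight for `N = 210`, `L = 5.348`, `Π_up = 18` exists (Perron vector of the
discretised operator; numerics Π(210) = 16.29 ≤ 17.90 certified with crude uniform cells). [folklore] -/
theorem stub_schurWeight_210 : ∃ w : ℝ → ℝ, SchurWeight 210 (5348 / 1000) 18 w := by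
  sorry

/-- STUB 3 (Theorem A′, ~300–400 lines over `SignConeCondRung{Mollifier,LowFreq,Assembly}`): with `H = 3 000 175 332 800`
(`platt_trudgian_numerical_rh`), `m = 4`, `h = 52/H`, `Y* = 0.15/h`: split `u = (u⋆φ-part)`… precisely `U = U⋆Ψ + V`,
`Ψ = φ + φ̃ − φ⋆φ̃`, `V = (u − u⋆φ)⋆(u − u⋆φ)~`; zeros give `W(U⋆Ψ) ≥ −0.05‖u‖²`, the archimedean density gives
`W(V) + V(0) ≥ (21.0 − Π_up)V(0) − 0.13‖u‖²`, the Krein–Turán bound charges the primes; sum ≥ 0. [folklore] -/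
theorem stub_unitSlackWeil_210_of_plattTrudgian (hPT : platt_trudgian_numerical_rh)
    (hKT : KreinTuranBound 210 (5348 / 1000) 18) :
    ∀ g : ℝ → ℂ, IsWeilTest g → tsupport g ⊆ Icc (-(Real.log 210 / 2)) (Real.log 210 / 2) →
      -(weilNorm2Sq g) ≤ (weilFunctional (weilConv g (weilReflect g))).re := by
  sorry

/-- **The rung at the 2001 benchmark, conditional on Platt–Trudgian** — the body of `SignConeUpTo210` (stmt-17940) verbatim,
from the three stubs (composition sorry-free; pattern of `signConeInequality_upTo_two_of_plattTrudgian`).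
[cite: PlattTrudgianBLMS2021, Theorem 1] -/
theorem signConeUpTo210_of_plattTrudgian (hPT : platt_trudgian_numerical_rh) :
    ∀ a : ℝ, 0 < a → a ≤ Real.log 210 / 2 → ∀ (k : ℕ) (g : Fin k → ℝ → ℂ), (∀ i, (ContDiff ℝ ((⊤ : ℕ∞) : WithTop ℕ∞) (g i) ∧ HasCompactSupport (g i)) ∧ tsupport (g i) ⊆ Set.Icc (-a) a) → let F : ℝ → ℂ := fun t => ∑ i, MeasureTheory.convolution (g i) (fun u => (starRingEnd ℂ) ((g i) (-u))) (ContinuousLinearMap.mul ℂ ℂ) MeasureTheory.MeasureSpace.volume t; (∀ n : ℕ, 2 ≤ n → 0 ≤ (F (Real.log n)).re) → let M : ℂ → ℂ := fun s => ∫ u : ℝ, F u * Complex.exp ((s - 1 / 2) * u); -(F 0).re ≤ (M 0 + M 1 + ((1 / (2 * Real.pi) : ℂ) * (∫ t : ℝ, M (1 / 2 + t * Complex.I) * ((Complex.digamma (1 / 4 + t / 2 * Complex.I)).re : ℂ)) - F 0 * (Real.log Real.pi : ℂ))).re := by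
  obtain ⟨w, hw⟩ := stub_schurWeight_210
  have hKT : KreinTuranBound 210 (5348 / 1000) 18 := stub_schurTest hw
  intro a _ha hab k g hg F hn M
  have hW : ∀ g : ℝ → ℂ, IsWeilTest g → tsupport g ⊆ Icc (-(Real.log 210 / 2)) (Real.log 210 / 2) →
      -(∫ t, ‖g t‖ ^ 2) ≤ (weilPolarTerm (weilConv g (weilReflect g)) + weilArchTerm (weilConv g (weilReflect g)) -
        ∑' n : ℕ, (((fun n => Λ n) n : ℝ) : ℂ) / (Real.sqrt n : ℂ) *
          (weilConv g (weilReflect g) (Real.log n) + weilConv g (weilReflect g) (-Real.log n))).re := by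
    intro g hg hs
    have h := stub_unitSlackWeil_210_of_plattTrudgian hPT hKT g hg hs
    unfold weilFunctional weilPrimeTerm at h
    unfold weilNorm2Sq at h
    rw [show weilPolarTerm (weilConv g (weilReflect g)) + weilArchTerm (weilConv g (weilReflect g)) -
        ∑' n : ℕ, (((fun n => Λ n) n : ℝ) : ℂ) / (Real.sqrt n : ℂ) * (weilConv g (weilReflect g) (Real.log n) +
          weilConv g (weilReflect g) (-Real.log n)) =
        weilPolarTerm (weilConv g (weilReflect g)) - ∑' n : ℕ, ((Λ n : ℝ) : ℂ) / (Real.sqrt n : ℂ) *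
          (weilConv g (weilReflect g) (Real.log n) + weilConv g (weilReflect g) (-Real.log n)) +
            weilArchTerm (weilConv g (weilReflect g)) by ring]
    exact h
  exact neg_re_apply_zero_le_re_weilArchPolar_of_fakeWeight_unitSlack (b := Real.log 210 / 2) (c := fun n => Λ n)
    (fun n => ArithmeticFunction.vonMangoldt_nonneg) hW (g := g) (F := F) rfl (fun i => (hg i).1)
    (fun i => (hg i).2.trans (Icc_subset_Icc (neg_le_neg hab) hab)) hn

end Summit.RiemannHypothesis.RiemannHypothesis.Cruxes.SignConeInequality.KreinTuran
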